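import Summits.BirchSwinnertonDyer.BirchSwinnertonDyer.Theorems.SignedLowerHalvesSmallImageLowerHalfBothSignsRttD2SeqJ3Strict
import Summits.BirchSwinnertonDyer.BirchSwinnertonDyer.Theorems.SignedLowerHalvesSmallImageLowerHalfBothSignsRttD2SeqJ3RInflation
import Summits.BirchSwinnertonDyer.BirchSwinnertonDyer.Theorems.SignedLowerHalvesSmallImageLowerHalfBothSignsRttD2SeqJ3LayerPairingOf
import Literature.NumberTheory.GaloisRepresentations.ContinuousShapiroLiftCores
import Literature.NumberTheory.GaloisRepresentations.ContinuousShapiroLiftMackeyH1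
import Literature.NumberTheory.GaloisRepresentations.ContinuousShapiroOpenCoinducedMackeyDegree
import Literature.NumberTheory.EllipticCurves.Kato2004.LocalIwasawaCohomology
import HarnessLib

/-!
# Route `SignedLowerHalves`, crux L `SmallImageLowerHalfBothSigns` (stmt-BirchSwinnertonDyer-23599), line `rtt_w3` v16 — E2, row J3 residual
# (`hsolL`), brick H6: THE STRICT CLAUSES FROM LOCAL TRIVIALITY OF THE SHAPIRO LIFT — a honda class `ȳ ∈ H¹(G_P(K_m), X_k)` whose inflated
# class has Shapiro lift `Sh_{U_m}(infl ȳ)` locally trivial at every place of `S₀` lies in g22's strict set `strictLevel S κ θ′ P S₀ m k`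
# (ALL localisations above `S₀` of ALL corestrictions `cor_{m→n′} ȳ`, `n′ ≤ m`, vanish)

WIDTH seat `bsd-line-slh-p3-w3` g23 under LEAD `cruxlead-stmt-BirchSwinnertonDyer-23599` g11 (cell `bsd-ssimc`); helper `--supports stmt-BirchSwinnertonDyer-23599`.
THEOREMS ONLY (no definition, no named fact, no instance, no `sorry`). HONEST FRAMING: bookkeeping between the Poitou–Tate output of H4 (`loc_w(Sh_U y) = 0` for
`w ∈ S₀`) and the junction's strict sets (p789744 `strictLevel`): Mackey at the level (`map_comapCoeffHom_conjMap_eq_zero_of_map_shapiroLift_eq_zero`), inflation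
commutes with corestriction (Kato2004's one-coset `map_coresLe_eq_coresLe_map` along `U_n → (U_n)_P`), and the Shapiro lifts carry corestriction to the fibre sum
(`cohomologyMap_coindFinSum_shapiroLift`), so local triviality descends along the tower. Nothing about any curve; E2, crux L, crux M, BSD remain OPEN and are proved
for NO curve.

* `inflNK_cycLayerCoresO` — `infl_n (cor_{K_{n+1}/K_n} ȳ) = cor_{U_{n+1} → U_n} (infl_{n+1} ȳ)` (needs `N_P ≤ U_{n+1}`).
* `locNK_cycLayerConjO_eq_zero_of_map_shapiroLift_eq_zero` — level clause: `θ_w^*(Sh_{U_n}(infl_n ȳ)) = 0 ⇒ loc_{n,w}(conj_δ ȳ) = 0` for all `δ ∈ Γ_K`.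
* `map_shapiroLift_coresLe_eq_zero` — `θ_w^*(Sh_{U′} y′) = 0 ⇒ θ_w^*(Sh_U (cor_{U′→U} y′)) = 0` (`U′ ≤ U`).
* ★★ `mem_strictLevel_of_map_shapiroLift_eq_zero` — `θ_w^*(Sh_{U_m}(infl_m ȳ)) = 0` for all `w ∈ S₀` ⇒ `ȳ ∈ strictLevel S κ θ′ P S₀ m k`.
References: [NeukirchSchmidtWingberg2008] I §5 Prop. 1.5.4, (1.5.6)–(1.5.7), I §6 Prop. (1.6.4), (8.6.2)–(8.6.3); [SerreLocalFields1979] VII §6; [Kato2004Asterisque] §17.13.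
-/

set_option autoImplicit false
set_option linter.dupNamespace false -- D-0017: single-problem summit, the namespace repeats the problem name by design
noncomputable section

open scoped Classical
open NumberField IsDedekindDomain Field CategoryTheory Function

namespace Summit.BirchSwinnertonDyer.BirchSwinnertonDyer.Theorems.SmallImageRttD2Seq

open Literature.NumberTheory.EllipticCurves Literature.NumberTheory.GaloisRepresentations
  Literature.NumberTheory.ComplexMultiplication.EllipticUnits.JohnsonLeungKings2011
  Summit.BirchSwinnertonDyer.BirchSwinnertonDyer.Theorems.SmallImageRttD2J1

section Strict

variable {K : Type} [Field K] [NumberField K] {p : ℕ} [Fact p.Prime] (S : Set (PadicAlgCl p)) (κ : ZpExtension K p)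
  (θ' : absoluteGaloisGroup K →ₜ* (padicCoeffIntegers S)ˣ) (P : Set (HeightOneSpectrum (𝓞 K)))

/-! ## §1. Inflation commutes with corestriction -/

omit [NumberField K] in
/-- `layerQuotHom (n+1)` and `layerQuotHom n` agree in `G_P` on `U_{n+1} ≤ U_n` (stated once, kernel-cheap). [folklore] -/
theorem layerQuotHom_succ_coe (n : ℕ) (x : ↥(κ.layerSubgroup (n + 1))) :
    ((layerQuotHom κ P (n + 1) x : ↥(imGS P (κ.layerSubgroup (n + 1)))) : GaloisGroupUnramifiedOutside K P) =
      ((layerQuotHom κ P n ⟨x, κ.layerSubgroup_antitone (Nat.le_succ n) x.2⟩ : ↥(imGS P (κ.layerSubgroup n))) : GaloisGroupUnramifiedOutside K P) := by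
  rw [layerQuotHom_apply_coe, layerQuotHom_apply_coe]

omit [NumberField K] in
/-- The coefficient morphism of `infl_n` is the identity on vectors (stated once, kernel-cheap). [folklore] -/
theorem inflMod_hom_apply (n k : ℕ) (m : ↥(Representation.invariants ((muTwistO S θ' k).toRepresentation.comp (ramificationSubgroup K P).subtype))) :
    (inflMod S κ θ' P n k).hom m = m :=
  rfl


/-- **`infl_n ∘ cor_{K_{n+1}/K_n} = cor_{U_{n+1}→U_n} ∘ infl_{n+1}`** on honda's layer classes: along `U_n → (U_n)_P` the relative corestriction of `(U_{n+1})_P ≤ (U_n)_P`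
(honda's `cycLayerCoresO` = the tree's `coresLe` on `G_P`, `relCoresO_one_eq_coresLe`) is carried to the tree's `coresLe` of `U_{n+1} ≤ U_n` (one coset system serves both sides:
`U_n ⧸ U_{n+1} = (U_n)_P ⧸ (U_{n+1})_P` as `N_P ≤ U_{n+1}`; Kato2004's `map_coresLe_eq_coresLe_map`). [cite: NeukirchSchmidtWingberg2008, I §5 Prop. 1.5.4 and (1.5.6)] -/
theorem inflNK_cycLayerCoresO (hNP : ∀ n, ramificationSubgroup K P ≤ κ.layerSubgroup n) (n k : ℕ)
    [Fintype (↥(κ.layerSubgroup n) ⧸ (κ.layerSubgroup (n + 1)).subgroupOf (κ.layerSubgroup n))] (y : cycLayerCohO S κ θ' P (n + 1) k 1) :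
    inflNK S κ θ' P n k (cycLayerCoresO S κ θ' P n k 1 y) =
      coresLe (coeffRepK S θ' P k).toTopRep (κ.layerSubgroup_antitone (Nat.le_succ n)) (κ.isOpen_layerSubgroup (n + 1)) (inflNK S κ θ' P (n + 1) k y) := by
  haveI := finite_imGS_quot P (U := κ.layerSubgroup n) (κ.isOpen_layerSubgroup (n + 1))
  letI : Fintype (↥(imGS P (κ.layerSubgroup n)) ⧸ (imGS P (κ.layerSubgroup (n + 1))).subgroupOf (imGS P (κ.layerSubgroup n))) := Fintype.ofFinite _
  rw [inflNK_apply, inflNK_apply, cycLayerCoresO,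
    relCoresO_one_eq_coresLe S θ' P (κ.layerSubgroup_antitone (Nat.le_succ n)) (κ.isOpen_layerSubgroup n) (κ.isOpen_layerSubgroup (n + 1)) k y]
  refine Kato2004.map_coresLe_eq_coresLe_map (coeffGSO S P θ' k).toTopRep (coeffRepK S θ' P k).toTopRep
    (imGS_le_of_le P (κ.layerSubgroup_antitone (Nat.le_succ n))) (isOpen_imGS_of_isOpen P (κ.isOpen_layerSubgroup (n + 1)))
    (κ.layerSubgroup_antitone (Nat.le_succ n)) (κ.isOpen_layerSubgroup (n + 1)) (layerQuotHom κ P n) (layerQuotHom κ P (n + 1))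
    (layerQuotHom_succ_coe κ P n) (fun x ↦ ?_) (fun g ↦ ?_) (inflMod S κ θ' P n k) (inflMod S κ θ' P (n + 1) k)
    (fun m ↦ by rw [inflMod_hom_apply, inflMod_hom_apply]) y
  · -- `ē(x) ∈ (U_{n+1})_P ↔ x ∈ U_{n+1}` (`N_P ≤ U_{n+1}`)
    rw [layerQuotHom_apply_coe]
    constructor
    · rintro ⟨u, hu, he⟩
      have h1 : u⁻¹ * (x : absoluteGaloisGroup K) ∈ ramificationSubgroup K P := by rw [← QuotientGroup.eq]; exact he
      have h2 := mul_mem hu (hNP (n + 1) h1)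
      rwa [mul_inv_cancel_left] at h2
    · exact fun hx ↦ Subgroup.mem_map_of_mem _ hx
  · -- one coset system: `ē` is onto `(U_n)_P`
    obtain ⟨u, hu, hug⟩ := Subgroup.mem_map.mp g.2
    refine ⟨⟨u, hu⟩, ?_⟩
    have hg : layerQuotHom κ P n ⟨u, hu⟩ = g := Subtype.ext hug
    rw [hg, inv_mul_cancel]
    exact one_mem _

/-! ## §2. The level clause -/

/-- **Level clause**: if `θ_w^*(Sh_{U_n}(infl_n ȳ)) = 0` in `H¹(K_w, Maps(Γ_K ⧸ U_n, X_k))` then `loc_{n,w}(conj_δ ȳ) = 0` for every `δ ∈ Γ_K` (Mackey for Shapiro lifts: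
`map_comapCoeffHom_conjMap_eq_zero_of_map_shapiroLift_eq_zero`, read through R4's `conjMap_inflNK`, `map_comapSubtypeHom_inflNK`).
[cite: NeukirchSchmidtWingberg2008, I §5 (1.5.6)–(1.5.7), I §6 Prop. (1.6.4)] -/
theorem locNK_cycLayerConjO_eq_zero_of_map_shapiroLift_eq_zero (w : HeightOneSpectrum (𝓞 K)) (n k : ℕ) [Fintype (absoluteGaloisGroup K ⧸ κ.layerSubgroup n)]
    {s : absoluteGaloisGroup K ⧸ κ.layerSubgroup n → absoluteGaloisGroup K} (hs : ∀ x, (s x : absoluteGaloisGroup K ⧸ κ.layerSubgroup n) = x)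
    (hs1 : s ((1 : absoluteGaloisGroup K) : absoluteGaloisGroup K ⧸ κ.layerSubgroup n) = 1) (y : cycLayerCohO S κ θ' P n k 1)
    (h0 : ContinuousCohomology.map (resGalOfEmb (closureEmb (K := K) (w.adicCompletion K)))
        (𝟙 (TopRep.res (resGalOfEmb (closureEmb (K := K) (w.adicCompletion K)) : absoluteGaloisGroup (w.adicCompletion K) →* absoluteGaloisGroup K) (coindFin.{0, 0} (coeffRepK S θ' P k).toTopRep (κ.layerSubgroup n)))) 1
        (shapiroLift (coeffRepK S θ' P k).toTopRep (κ.layerSubgroup n) (κ.isOpen_layerSubgroup n) hs hs1 (inflNK S κ θ' P n k y)) = 0)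
    (δ : absoluteGaloisGroup K) : locNK S κ θ' P w n k (cycLayerConjO S κ θ' P n k 1 δ y) = 0 := by
  letI : Fintype (absoluteGaloisGroup (w.adicCompletion K) ⧸ (κ.layerSubgroup n).comap (resGalOfEmb (closureEmb (K := K) (w.adicCompletion K)) : absoluteGaloisGroup (w.adicCompletion K) →* absoluteGaloisGroup K)) := fintypeQuotLocalLayer κ w n
  obtain ⟨sD, hsD, hsD1⟩ := exists_reps_one (G := absoluteGaloisGroup (w.adicCompletion K)) ((κ.layerSubgroup n).comap (resGalOfEmb (closureEmb (K := K) (w.adicCompletion K)) : absoluteGaloisGroup (w.adicCompletion K) →* absoluteGaloisGroup K))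
  rw [← map_comapSubtypeHom_inflNK, ← conjMap_inflNK]
  exact map_comapCoeffHom_conjMap_eq_zero_of_map_shapiroLift_eq_zero (coeffRepK S θ' P k).toTopRep (κ.layerSubgroup n)
    (resGalOfEmb (closureEmb (K := K) (w.adicCompletion K))) (κ.isOpen_layerSubgroup n) hs hs1 hsD hsD1 (inflNK S κ θ' P n k y) h0 δ

/-! ## §3. Local triviality of Shapiro lifts descends along corestriction -/

/-- **`θ_w^*(Sh_{U′} y′) = 0 ⇒ θ_w^*(Sh_U(cor_{U′→U} y′)) = 0`** for open subgroups `U′ ≤ U` of finite index: `Sh_U ∘ cor = H¹(Σ) ∘ Sh_{U′}` (fibre sum,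
`cohomologyMap_coindFinSum_shapiroLift`) and `θ_w^*` is natural. [cite: NeukirchSchmidtWingberg2008, I §5 (1.5.6)–(1.5.7), I §6 Prop. (1.6.4)] [cite: SerreLocalFields1979, VII §6] -/
theorem map_shapiroLift_coresLe_eq_zero (X : TopRep.{0} ℤ (absoluteGaloisGroup K))
    {U U' : Subgroup (absoluteGaloisGroup K)} (h : U' ≤ U) (hU : IsOpen (U : Set (absoluteGaloisGroup K))) (hU' : IsOpen (U' : Set (absoluteGaloisGroup K)))
    [Fintype (absoluteGaloisGroup K ⧸ U)] [Fintype (absoluteGaloisGroup K ⧸ U')] [Fintype (↥U ⧸ U'.subgroupOf U)]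
    {s : absoluteGaloisGroup K ⧸ U → absoluteGaloisGroup K} (hs : ∀ x, (s x : absoluteGaloisGroup K ⧸ U) = x) (hs1 : s ((1 : absoluteGaloisGroup K) : _ ⧸ U) = 1)
    {s' : absoluteGaloisGroup K ⧸ U' → absoluteGaloisGroup K} (hs' : ∀ x, (s' x : absoluteGaloisGroup K ⧸ U') = x) (hs'1 : s' ((1 : absoluteGaloisGroup K) : _ ⧸ U') = 1)
    (w : HeightOneSpectrum (𝓞 K)) (y' : continuousCohomology 1 (subgroupRep X U'))
    (h0 : ContinuousCohomology.map (resGalOfEmb (closureEmb (K := K) (w.adicCompletion K))) (𝟙 (TopRep.res (resGalOfEmb (closureEmb (K := K) (w.adicCompletion K)) : absoluteGaloisGroup (w.adicCompletion K) →* absoluteGaloisGroup K) (coindFin.{0, 0} X U'))) 1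
      (shapiroLift X U' hU' hs' hs'1 y') = 0) :
    ContinuousCohomology.map (resGalOfEmb (closureEmb (K := K) (w.adicCompletion K))) (𝟙 (TopRep.res (resGalOfEmb (closureEmb (K := K) (w.adicCompletion K)) : absoluteGaloisGroup (w.adicCompletion K) →* absoluteGaloisGroup K) (coindFin.{0, 0} X U))) 1
      (shapiroLift X U hU hs hs1 (coresLe X h hU' y')) = 0 := by
  rw [← cohomologyMap_coindFinSum_shapiroLift X h hU hU' hs hs1 hs' hs'1 y']
  have h1 := map_cohomologyMap_eq_map (resGalOfEmb (closureEmb (K := K) (w.adicCompletion K))) (coindFinSum X h)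
    (𝟙 (TopRep.res (resGalOfEmb (closureEmb (K := K) (w.adicCompletion K)) : absoluteGaloisGroup (w.adicCompletion K) →* absoluteGaloisGroup K) (coindFin.{0, 0} X U))) 1 (shapiroLift X U' hU' hs' hs'1 y')
  rw [Category.comp_id] at h1
  have h2 := cohomologyMap_map_id_eq_map (coindFin.{0, 0} X U') (resGalOfEmb (closureEmb (K := K) (w.adicCompletion K)))
    ((TopRep.resFunctor (resGalOfEmb (closureEmb (K := K) (w.adicCompletion K)) : absoluteGaloisGroup (w.adicCompletion K) →* absoluteGaloisGroup K)).map (coindFinSum X h)) 1 (shapiroLift X U' hU' hs' hs'1 y')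
  change (ContinuousCohomology.map _ _ 1).hom (cohomologyMap (coindFinSum X h) 1 _) = 0
  rw [h1, ← h2]
  change cohomologyMap _ 1 ((ContinuousCohomology.map _ (𝟙 (TopRep.res (resGalOfEmb (closureEmb (K := K) (w.adicCompletion K)) : absoluteGaloisGroup (w.adicCompletion K) →* absoluteGaloisGroup K) (coindFin.{0, 0} X U'))) 1) (shapiroLift X U' hU' hs' hs'1 y')) = 0
  rw [h0, map_zero]

/-! ## §4. The strict clauses -/

/-- ★★ **Local triviality of the Shapiro lift above `S₀` puts a honda class in the strict set.** If `N_P ≤ U_n` for all `n` and the inflated class of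
`ȳ ∈ H¹(G_P(K_m), X_k)` has Shapiro lift `Sh_{U_m}(infl_m ȳ)` with `θ_w^*(Sh_{U_m}(infl_m ȳ)) = 0` for every `w ∈ S₀`, then `ȳ ∈ strictLevel S κ θ′ P S₀ m k`:
`loc_{n′,w}(conj_δ(cor_{m→n′} ȳ)) = 0` for all `n′ ≤ m`, `w ∈ S₀`, `δ ∈ Γ_K` (descending induction on the layer: §1 + §3 carry the hypothesis from `m` to `n′`, §2 reads it
at each level). [cite: NeukirchSchmidtWingberg2008, I §5 Prop. 1.5.4, (1.5.6)–(1.5.7), (8.6.2)–(8.6.3)] [cite: PerrinRiou1987, §4] -/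
theorem mem_strictLevel_of_map_shapiroLift_eq_zero (hNP : ∀ n, ramificationSubgroup K P ≤ κ.layerSubgroup n) (S₀ : Set (HeightOneSpectrum (𝓞 K))) (m k : ℕ)
    [hF : ∀ n : ℕ, Fintype (absoluteGaloisGroup K ⧸ κ.layerSubgroup n)]
    [hR : ∀ n : ℕ, Fintype (↥(κ.layerSubgroup n) ⧸ (κ.layerSubgroup (n + 1)).subgroupOf (κ.layerSubgroup n))]
    {s : absoluteGaloisGroup K ⧸ κ.layerSubgroup m → absoluteGaloisGroup K} (hs : ∀ x, (s x : absoluteGaloisGroup K ⧸ κ.layerSubgroup m) = x)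
    (hs1 : s ((1 : absoluteGaloisGroup K) : absoluteGaloisGroup K ⧸ κ.layerSubgroup m) = 1) (y : cycLayerCohO S κ θ' P m k 1)
    (h0 : ∀ w ∈ S₀, ContinuousCohomology.map (resGalOfEmb (closureEmb (K := K) (w.adicCompletion K)))
        (𝟙 (TopRep.res (resGalOfEmb (closureEmb (K := K) (w.adicCompletion K)) : absoluteGaloisGroup (w.adicCompletion K) →* absoluteGaloisGroup K) (coindFin.{0, 0} (coeffRepK S θ' P k).toTopRep (κ.layerSubgroup m)))) 1
        (shapiroLift (coeffRepK S θ' P k).toTopRep (κ.layerSubgroup m) (κ.isOpen_layerSubgroup m) hs hs1 (inflNK S κ θ' P m k y)) = 0) :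
    y ∈ strictLevel S κ θ' P S₀ m k := by
  -- the rep-free form of the hypothesis at a level: vanishing for ALL systems of representatives
  have key : ∀ (n' : ℕ) (h : n' ≤ m) (w : HeightOneSpectrum (𝓞 K)), w ∈ S₀ →
      ∀ {t : absoluteGaloisGroup K ⧸ κ.layerSubgroup n' → absoluteGaloisGroup K} (ht : ∀ x, (t x : absoluteGaloisGroup K ⧸ κ.layerSubgroup n') = x)
        (ht1 : t ((1 : absoluteGaloisGroup K) : absoluteGaloisGroup K ⧸ κ.layerSubgroup n') = 1),
        ContinuousCohomology.map (resGalOfEmb (closureEmb (K := K) (w.adicCompletion K)))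
          (𝟙 (TopRep.res (resGalOfEmb (closureEmb (K := K) (w.adicCompletion K)) : absoluteGaloisGroup (w.adicCompletion K) →* absoluteGaloisGroup K) (coindFin.{0, 0} (coeffRepK S θ' P k).toTopRep (κ.layerSubgroup n')))) 1
          (shapiroLift (coeffRepK S θ' P k).toTopRep (κ.layerSubgroup n') (κ.isOpen_layerSubgroup n') ht ht1
            (inflNK S κ θ' P n' k (cycCoresLE S κ θ' P 1 h k y))) = 0 := by
    intro n' h
    induction m, h using Nat.le_induction with
    | base =>
      intro w hw t ht ht1
      rw [cycCoresLE_refl, ← shapiroLift_eq_of_reps _ _ _ hs hs1 ht ht1]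
      exact h0 w hw
    | succ m h ih =>
      intro w hw t ht ht1
      rw [← cycCoresLE_trans S κ θ' P 1 h (Nat.le_succ m), cycCoresLE_succ]
      obtain ⟨sm, hsm, hsm1⟩ := exists_reps_one (G := absoluteGaloisGroup K) (κ.layerSubgroup m)
      refine ih hsm hsm1 (cycLayerCoresO S κ θ' P m k 1 y) (fun w' hw' ↦ ?_) w hw ht ht1
      rw [inflNK_cycLayerCoresO S κ θ' P hNP m k y]
      exact map_shapiroLift_coresLe_eq_zero (coeffRepK S θ' P k).toTopRep (κ.layerSubgroup_antitone (Nat.le_succ m)) (κ.isOpen_layerSubgroup m)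
        (κ.isOpen_layerSubgroup (m + 1)) hsm hsm1 hs hs1 w' _ (h0 w' hw')
  rw [mem_strictLevel_iff]
  intro n' h w hw δ
  obtain ⟨t, ht, ht1⟩ := exists_reps_one (G := absoluteGaloisGroup K) (κ.layerSubgroup n')
  exact locNK_cycLayerConjO_eq_zero_of_map_shapiroLift_eq_zero S κ θ' P w n' k ht ht1 _ (key n' h w hw ht ht1) δ

end Strict

end Summit.BirchSwinnertonDyer.BirchSwinnertonDyer.Theorems.SmallImageRttD2Seq

end
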